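import Summits.HodgeConjecture.HodgeConjecture.Theses.NikulinTwinTransport
import Summits.HodgeConjecture.Statement
import Literature.AlgebraicGeometry.HodgeTheory.HodgeClassOfMorphismDischarge
import Literature.AlgebraicGeometry.HodgeTheory.ComplexGysinCorrespondence
import Literature.AlgebraicGeometry.HodgeTheory.ComplexConjugationHolds
import Literature.AlgebraicGeometry.HodgeTheory.HodgeFiltrationModelsReductionProofs

/-!
# Route NikulinTwinTransport · `RealMultiplicationSqrtTwoAlgebraic` (stmt-HodgeConjecture-13679) is implied by the
# Hodge conjecture — WITHOUT the marking fact

The landed `realMultiplicationSqrtTwoAlgebraic_of_hodgeConjecture` (`NikulinTwinTransportRealMultiplicationOfHodgeConjecture.lean`)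
derives the route item `RealMultiplicationSqrtTwoAlgebraic` (the class of real multiplication by `√2` on a
projective K3 surface is algebraic) from the Hodge conjecture GRANTED the named fact
`Huybrechts_K3_marking_exists` (through the marked canonical class `Υ_e`). Here the marking is removed:
every rational Hodge endomorphism `e` of `H²(S(ℂ); ℂ)` of a smooth projective surface is `t • γ_*`,
`t ≠ 0`, for a RATIONAL `(2,2)`-class `γ` on `S ⊗ S` by Voisin I Lemma 11.41 in the tree's discharged form
`exists_hodgeClass_corrAction_eq_smul_holds` (any orientation family); the Hodge conjecture for `S ⊗ S` in
codimension `2` makes `γ` algebraic.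

* `hodgeEndomorphism_induced_of_hodgeConjectureFor_square_free` — for ANY smooth projective surface `S`
  with `HodgeConjectureFor 4 (S ⊗ S)`, every rational type-preserving endomorphism of `H²(S(ℂ); ℂ)` is
  induced by an algebraic class (marking-free form of `hodgeEndomorphisms_induced_of_hodgeConjectureFor_square`);
* `realMultiplicationSqrtTwoAlgebraic_of_hodgeConjectureFor_squares_free`,
  `realMultiplicationSqrtTwoAlgebraic_of_hodgeConjecture_free` — the route decl BY NAME from HC for the
  squares of projective K3 surfaces, resp. from the summit statement; no named-fact hypothesis. So a
  refutation of the item refutes the Hodge conjecture.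

No definition, no named-fact hypothesis, no sorry. Prover seat ring2-b02 (gen 47).

References: Voisin, *Hodge Theory and Complex Algebraic Geometry I*, §11.3.3 Thm. 11.38 and Lemma 11.41;
Varesco (2023), §2 p. 8; Deligne, *The Hodge conjecture* (Clay 2000), §1.
-/

set_option linter.dupNamespace false

noncomputable section

namespace Summit.HodgeConjecture.HodgeConjecture.Theorems.NikulinTwinTransport.SquareGlueFree

open scoped Manifold
open CategoryTheory MonoidalCategory CartesianMonoidalCategory
open Literature.AlgebraicGeometry Literature.AlgebraicGeometry.Motives Literature.AlgebraicGeometry.HodgeTheory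
open Literature.AlgebraicTopology.SingularHomology

variable {S : SchemeOver ℂ}

/-- **Granted `HodgeConjectureFor 4 (S ⊗ S)`, every rational Hodge endomorphism of `H²(S(ℂ); ℂ)` of a smooth
projective surface is induced by an ALGEBRAIC class of codimension `2` on `S ⊗ S`**, for every orientation
family (Voisin I Lemma 11.41 discharged: `exists_hodgeClass_corrAction_eq_smul_holds`; then HC in codimension
`2`). Marking-free. [cite: VoisinHodgeI2002, §11.3.3 Thm. 11.38 and Lemma 11.41] [cite: Varesco2023, §2 (p. 8)] -/
theorem hodgeEndomorphism_induced_of_hodgeConjectureFor_square_free (μ : OrientationFamily)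
    (hS : IsSmoothProjective 2 S) (hHC : HodgeConjectureFor 4 (S ⊗ S))
    (G : complexBetti S (2 * 1) →ₗ[ℂ] complexBetti S (2 * 1))
    (hG_rat : ∀ x, IsRationalClass x → IsRationalClass (G x))
    (hG_typ : ∀ (i j : ℕ) x, IsOfHodgeType 2 S (2 * 1) i j x → IsOfHodgeType 2 S (2 * 1) i j (G x)) :
    ∃ γ ∈ algebraicClasses (S ⊗ S) 2, ∀ x : complexBetti S (2 * 1),
      G x = complexGysin μ (IsSmoothProjective.tensor_holds hS hS) hS (SemiCartesianMonoidalCategory.fst S S)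
        (rfl : 2 * 1 + 2 * 2 + 2 * 2 = 2 * 1 + 2 * (2 + 2))
        (cupProduct (rfl : 2 * 1 + 2 * 2 = 2 * 1 + 2 * 2)
          (complexBetti.map (SemiCartesianMonoidalCategory.snd S S) (2 * 1) x) γ) := by
  have hI := hodgePQ_independent_of_hodgeModel_holds
  obtain ⟨A⟩ := nonempty_hodgeModel_holds (n := 2) (X := S) hS
  obtain ⟨γ, hγQ, hγT, t, ht0, hγ⟩ := exists_hodgeClass_corrAction_eq_smul_holds hS hS A A
    (a := 2 * 1) (b := 2 * 1) (e := 2) (r := 0) (rfl : 2 * 1 + 2 * 2 = 2 * 1 + 2 * 2) (rfl : 2 + 0 = 2) G hG_rat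
    (fun p q _ c hc ↦ by
      rw [Nat.add_zero, Nat.add_zero]
      exact (hI.isOfHodgeType_iff hS A).1 (hG_typ p q c ((hI.isOfHodgeType_iff hS A).2 hc))) μ
  have hγalg : γ ∈ algebraicClasses (S ⊗ S) 2 := hHC.2 2 γ hγQ hγT
  refine ⟨t⁻¹ • γ, Submodule.smul_mem _ _ hγalg, fun x ↦ ?_⟩
  have h := LinearMap.congr_fun hγ x
  rw [LinearMap.smul_apply, corrAction_apply] at h
  rw [map_smul, map_smul, h, smul_smul, inv_mul_cancel₀ ht0, one_smul]

/-- **`RealMultiplicationSqrtTwoAlgebraic` from the Hodge conjecture for the squares of projective K3 surfaces,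
with NO named-fact hypothesis** (of the item's hypotheses on `e` only rationality and type preservation are
used). [cite: Varesco2023, §2 (p. 8)] [cite: VoisinHodgeI2002, §11.3.3 Lemma 11.41] -/
theorem realMultiplicationSqrtTwoAlgebraic_of_hodgeConjectureFor_squares_free
    (hHC : ∀ S : SchemeOver ℂ, Literature.AlgebraicGeometry.Surfaces.IsK3Surface S → HodgeConjectureFor 4 (S ⊗ S)) :
    Theses.NikulinTwinTransport.RealMultiplicationSqrtTwoAlgebraic := by
  intro μ _ S hS e he_rat he_typ _ _ _
  exact hodgeEndomorphism_induced_of_hodgeConjectureFor_square_free μ hS.1 (hHC S hS) e he_rat he_typ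

/-- **`RealMultiplicationSqrtTwoAlgebraic` from the Hodge conjecture, with NO named-fact hypothesis**: the item
is a correctly rendered sub-case of the summit (a refutation of it refutes the Hodge conjecture).
[cite: Deligne2000, §1] [cite: Varesco2023, §2 (p. 8)] -/
theorem realMultiplicationSqrtTwoAlgebraic_of_hodgeConjecture_free (hHC : _root_.HodgeConjecture) :
    Theses.NikulinTwinTransport.RealMultiplicationSqrtTwoAlgebraic :=
  realMultiplicationSqrtTwoAlgebraic_of_hodgeConjectureFor_squares_free
    fun _ hS ↦ hHC (IsSmoothProjective.tensor_holds hS.isSmoothProjective hS.isSmoothProjective)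

end Summit.HodgeConjecture.HodgeConjecture.Theorems.NikulinTwinTransport.SquareGlueFree

end
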